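import Summits.BirchSwinnertonDyer.Rank1Residual.X11b.CongruentTransferPotGoodAbove
import Summits.BirchSwinnertonDyer.Rank1Residual.Additive.CyclotomicGoodReduction
import Summits.BirchSwinnertonDyer.Rank1Residual.Additive.JValuationOfIntModel
import Mathlib.FieldTheory.KummerPolynomial
import HarnessLib

/-!
# Good reduction of `E_{K'}` above `p` over `K' = ℚ(p^{1/e})` and the `(d3)` disjunct at `v = p` for
# additive potentially-good congruent pairs (class X11b, cell `b2b-bsdres`, unit `b2b-bsdres-sha-2`,
# gen 28; part (e6))

HONEST FRAMING (run/shared/lean/b2b/bsd-rank1-residual/, verbatim in every file): prove what is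
provable now; shrink each hard class to its core with data; no claim beyond stated classes. TOOL
theorems + ONE bookkeeping type (`RootField e p = ℚ[X]/(X^e − p)`); nothing is booked; no label /
mark / count moves; no named fact is added (the only non-elementary input stays the REGISTERED named
fact A308, hypothesis `hMR` of the final lemma); no `sorry`.

## What

* §1 `hasGoodReductionAt_baseChange_of_pow_eq_natCast` — GOOD REDUCTION ABOVE `p` FROM A ROOT: for
  `W/ℚ`, `p ≥ 5`, `ord_p j(W) ≥ 0`, a number field `K'` containing `π` with `π^e = p`, and
  `12·t = e·ord_p Δ(W)`: `W_{K'}` has good reduction at every place `w ∣ p` of `K'`.  Proof = the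
  tree's `hasGoodReductionAt_of_valuation_j_le_one_of_valuation_pow_twelve` (Silverman VII.5.1(a),
  Rem. VII.1.1; file `Additive/CyclotomicGoodReduction.lean`) with `δ = π^t`:
  `w(δ)¹² = w(π)^{e·ord_p Δ} = w(p)^{ord_p Δ} = w(Δ)` (`valuation_liesOver` for `Δ` and for `p`; NO
  decomposition of `p` in `K'` and no `e(w|p)` is computed).
* §2 `RootField e p := AdjoinRoot (X^e − p)` (`e`, `p` primes): a number field (Mathlib), of degree
  `e` for EVERY `ℚ`-algebra structure (`finrank_rootField`; `X^e − p` is irreducible by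
  `X_pow_sub_C_irreducible_of_prime` — `p` is not an `e`-th power in `ℚ` since `ord_p` of an `e`-th
  power is divisible by `e`), with `(root)^e = p` (`root_pow_rootField`).
* §3 `localLe_of_potGood_root` — THE `(d3)` DISJUNCT AT `v ∣ p` of the GEN 27 consumers
  `bsdp_of_congruent_*_localLe` for a `p`-congruent pair `W`, `Y` over `ℚ`, BOTH additive potentially
  good at `p ≥ 5` with `12·t = e·ord_p Δ` on both sides for one prime `e` with `e + 1 < p`
  (the 27 RESIDUAL-28 rows: `e = 2`, `p = 5` (`I₀*`); `e = 3`, `p = 5, 7` (`IV`, `IV*`)): part (e5)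
  `localLe_of_goodReduction_above_tower_rat` over `K' = RootField e p` (`[K' : ℚ] = e < p − 1`) with
  the certificates of §1 on both sides.  Record-level numerals: `0 ≤ ord_p j` and `ord_p Δ = n`
  (kernel-decided on the integer models via the tree's `IntModel` API), `12 t = e n` (`decide`);
  `localLe_of_potGood_root_of_intModel` is the record-facing form whose numeric hypotheses are the
  integer divisibilities `p^a ∣ c₄(E₀)`, `p^n ∥ Δ(E₀)`, `n ≤ 3a`, `12 t = e n` on the two minimal
  integer models (each closed by `decide` in a record).

References: B. Mazur, K. Rubin, *Selmer companion curves*, Trans. AMS 367 (2015) Thm. 3.1 / §6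
[MazurRubin2015SelmerCompanions]; J.-P. Serre, J. Tate, *Good reduction of abelian varieties*, Ann.
of Math. 88 (1968) §2 Cor. 2; J. H. Silverman, *AEC* VII.5 Prop. 5.1(a), Rem. VII.1.1, App. C §16
[SilvermanAEC2009]; A. Kraus, Manuscripta Math. 69 (1990) (semistability defect `12/gcd(12, v(Δ))`).
-/

set_option autoImplicit false

noncomputable section

open scoped Classical NumberField

open Polynomial WeierstrassCurve IsDedekindDomain IsDedekindDomain.HeightOneSpectrum NumberField
open Literature.NumberTheory.EllipticCurves
open Literature.NumberTheory.GaloisRepresentations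
open Summit.BirchSwinnertonDyer.Rank1Residual.Additive
open Summit.BirchSwinnertonDyer.BirchSwinnertonDyer.Rank1Residual

namespace Summit.BirchSwinnertonDyer.Rank1Residual.X11b.CongruentTransfer

/-! ### §1 Good reduction above `p` from a root `π^e = p` -/

/-- **Good reduction of `W_{K'}` above `p` from `π ∈ K'`, `π^e = p`, `12 t = e·ord_p Δ`, `ord_p j ≥ 0`**
(`p ≥ 5`). At a place `w ∋ p` of `K'`: `2, 3 ∉ w`; `w(j) = v_p(j)^{e(w|p)} ≤ 1`; and with `δ = π^t`,
`w(δ)¹² = w(π)^{12t} = (w(π)^e)^{ord_p Δ} = w(p)^{ord_p Δ} = (v_p(p)^{ord_p Δ})^{e(w|p)} =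
v_p(Δ)^{e(w|p)} = w(Δ)` (Mathlib `valuation_liesOver` twice), so
`hasGoodReductionAt_of_valuation_j_le_one_of_valuation_pow_twelve` applies. (Serre–Tate: a curve with
potentially good reduction and `12 ∣ e(L_w|ℚ_p)·ord_p Δ` has good reduction over `L_w`, for `p ≥ 5`.)
[cite: SilvermanAEC2009, VII.5 Prop. 5.1(a) and Rem. VII.1.1] -/
theorem hasGoodReductionAt_baseChange_of_pow_eq_natCast (W : WeierstrassCurve ℚ) [W.IsElliptic]
    (p : ℕ) [hp : Fact p.Prime] (hp5 : 5 ≤ p) (hj : 0 ≤ padicValRat p W.j)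
    (K' : Type) [Field K'] [NumberField K'] {e t n : ℕ} (π : K') (hπ : π ^ e = (p : K'))
    (hn : padicValRat p W.Δ = n) (ht : 12 * t = e * n)
    (w : HeightOneSpectrum (𝓞 K')) (hw : ((p : ℕ) : 𝓞 K') ∈ w.asIdeal) :
    (W.baseChange K').HasGoodReductionAt w := by
  -- the place of `ℤ` below `w` is `(p)`
  set v : HeightOneSpectrum ℤ := (Rat.HeightOneSpectrum.primesEquiv (R := ℤ)).symm ⟨p, hp.out⟩
    with hvdef
  have hv : Rat.HeightOneSpectrum.natGenerator v = p :=
    congrArg Subtype.val ((Rat.HeightOneSpectrum.primesEquiv (R := ℤ)).apply_symm_apply ⟨p, hp.out⟩)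
  have hvspan : v.asIdeal = Ideal.span {(p : ℤ)} := by
    rw [Rat.HeightOneSpectrum.asIdeal_eq_span_natGenerator_int, hv]
  have hunder : w.asIdeal.under ℤ = v.asIdeal := by
    have hle : v.asIdeal ≤ w.asIdeal.under ℤ := by
      rw [hvspan, Ideal.span_le, Set.singleton_subset_iff, SetLike.mem_coe, Ideal.under_def,
        Ideal.mem_comap, map_natCast]
      exact hw
    exact (v.isMaximal.eq_of_le (Ideal.IsPrime.ne_top inferInstance) hle).symm
  haveI hlies : w.asIdeal.LiesOver v.asIdeal := ⟨hunder.symm⟩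
  -- `2, 3 ∉ w`
  have hnotMem : ∀ q : ℕ, q < p → q ≠ 0 → (q : 𝓞 K') ∉ w.asIdeal := by
    intro q hq hq0 hmem
    have h1 : (q : ℤ) ∈ w.asIdeal.under ℤ := by
      rw [Ideal.under_def, Ideal.mem_comap, map_natCast]; exact hmem
    rw [hunder, hvspan, Ideal.mem_span_singleton] at h1
    have h2 : p ∣ q := by exact_mod_cast h1
    exact absurd (Nat.le_of_dvd (Nat.pos_of_ne_zero hq0) h2) (not_le.mpr hq)
  have h2 : (2 : 𝓞 K') ∉ w.asIdeal := by simpa using hnotMem 2 (by omega) two_ne_zero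
  have h3 : (3 : 𝓞 K') ∉ w.asIdeal := by simpa using hnotMem 3 (by omega) three_ne_zero
  -- the curve upstairs
  haveI : (W.baseChange K').IsElliptic := by rw [baseChange]; infer_instance
  have hjF : (W.baseChange K').j = algebraMap ℚ K' W.j := W.map_j (algebraMap ℚ K')
  have hΔF : (W.baseChange K').Δ = algebraMap ℚ K' W.Δ := by rw [baseChange, map_Δ]
  -- `w(j) ≤ 1`
  have hjw : w.valuation K' (W.baseChange K').j ≤ 1 := by
    rw [hjF, ← valuation_liesOver (K := ℚ) (L := K') v w W.j]
    apply pow_le_one₀ zero_le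
    by_cases hj0 : W.j = 0
    · rw [hj0, map_zero]; exact zero_le
    rw [Rat.HeightOneSpectrum.valuation_eq_exp_neg_padicValRat v hj0, hv, ← WithZero.exp_zero,
      WithZero.exp_le_exp]
    linarith
  -- `v_p(Δ) = v_p(p)^n`
  have hΔ0 : W.Δ ≠ 0 := W.isUnit_Δ.ne_zero
  have hvp : v.valuation ℚ (p : ℚ) = WithZero.exp (-1 : ℤ) := by
    have h := Rat.HeightOneSpectrum.valuation_natGenerator_int v
    rwa [hv] at h
  have hvΔ : v.valuation ℚ W.Δ = v.valuation ℚ (p : ℚ) ^ n := by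
    rw [Rat.HeightOneSpectrum.valuation_eq_exp_neg_padicValRat v hΔ0, hv, hn, hvp,
      ← WithZero.exp_nsmul]
    simp
  -- `w(π^t)¹² = w(Δ)`
  have hδ : w.valuation K' (π ^ t) ^ 12 = w.valuation K' (W.baseChange K').Δ := by
    rw [hΔF, ← valuation_liesOver (K := ℚ) (L := K') v w W.Δ, hvΔ, ← pow_mul, mul_comm n, pow_mul,
      valuation_liesOver (K := ℚ) (L := K') v w (p : ℚ), map_natCast, ← hπ, map_pow, map_pow,
      ← pow_mul, ← pow_mul]
    congr 1
    omega
  exact hasGoodReductionAt_of_valuation_j_le_one_of_valuation_pow_twelve (W.baseChange K') h2 h3 hjw hδ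

/-! ### §2 The root field `ℚ(p^{1/e})` -/

/-- **`X^e − p` is irreducible over `ℚ`** for primes `e`, `p` (`p` is not an `e`-th power in `ℚ`:
`ord_p(b^e) = e·ord_p(b) ≠ 1`; Mathlib `X_pow_sub_C_irreducible_of_prime`). [folklore] -/
theorem X_pow_sub_C_natCast_irreducible {e p : ℕ} (he : e.Prime) (hp : p.Prime) :
    Irreducible (X ^ e - C (p : ℚ)) := by
  haveI : Fact p.Prime := ⟨hp⟩
  refine X_pow_sub_C_irreducible_of_prime he fun b hb => ?_
  have hb0 : b ≠ 0 := by
    rintro rfl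
    rw [zero_pow he.ne_zero] at hb
    exact_mod_cast (show (p : ℚ) ≠ 0 by exact_mod_cast hp.ne_zero) hb.symm
  have h := congrArg (padicValRat p) hb
  rw [padicValRat.pow, padicValRat.self hp.one_lt] at h
  have h1 : (e : ℤ) = 1 := Int.eq_one_of_mul_eq_one_right (by positivity) h
  exact he.one_lt.ne' (by exact_mod_cast h1)

/-- Irreducibility of `X^e − p` as a `Fact` (so that `AdjoinRoot (X^e − p)` is a field). [folklore] -/
instance fact_irreducible_X_pow_sub_C_natCast (e p : ℕ) [he : Fact e.Prime] [hp : Fact p.Prime] :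
    Fact (Irreducible (X ^ e - C (p : ℚ))) :=
  ⟨X_pow_sub_C_natCast_irreducible he.out hp.out⟩

/-- **`ℚ(p^{1/e}) = ℚ[X]/(X^e − p)`** (`e`, `p` primes): a number field (Mathlib's instance for
`AdjoinRoot` of an irreducible polynomial over `ℚ`). H21 bookkeeping definition. [folklore] -/
abbrev RootField (e p : ℕ) [Fact e.Prime] [Fact p.Prime] : Type := AdjoinRoot (X ^ e - C (p : ℚ))

section RootField

variable (e p : ℕ) [he : Fact e.Prime] [hp : Fact p.Prime]

/-- `π = the class of X` in `ℚ(p^{1/e})`. [folklore] -/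
def rootFieldGen : RootField e p := AdjoinRoot.root (X ^ e - C (p : ℚ))

/-- **`π^e = p`** in `ℚ(p^{1/e})`. [folklore] -/
theorem rootFieldGen_pow : rootFieldGen e p ^ e = (p : RootField e p) := by
  have h : eval₂ (AdjoinRoot.of (X ^ e - C (p : ℚ))) (AdjoinRoot.root (X ^ e - C (p : ℚ)))
      (X ^ e - C (p : ℚ)) = 0 := AdjoinRoot.eval₂_root _
  rw [eval₂_sub, eval₂_pow, eval₂_X, eval₂_C, sub_eq_zero] at h
  exact h.trans (map_natCast _ _)

/-- **`[ℚ(p^{1/e}) : ℚ] = e`** — for ANY `ℚ`-algebra structure (they all coincide,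
`algebra_rat_subsingleton`; the power basis `1, π, …, π^{e−1}` of `AdjoinRoot`). [folklore] -/
theorem finrank_rootField (A : Algebra ℚ (RootField e p)) :
    @Module.finrank ℚ (RootField e p) _ _ A.toModule = e := by
  have hA : A = AdjoinRoot.instAlgebra (X ^ e - C (p : ℚ)) := Subsingleton.elim _ _
  subst hA
  have hf : (X ^ e - C (p : ℚ)) ≠ 0 := (X_pow_sub_C_natCast_irreducible he.out hp.out).ne_zero
  rw [PowerBasis.finrank (AdjoinRoot.powerBasis hf), AdjoinRoot.powerBasis_dim, natDegree_X_pow_sub_C]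

end RootField

/-! ### §3 The `(d3)` disjunct at `v ∣ p` for PG/PG congruent pairs -/

/-- **The one-directional local inclusion at `v ∣ p` for a `p`-congruent pair, BOTH additive
potentially good at `p`, with semistability defect dividing a prime `e < p − 1`.** Hypotheses (all
record-level numerals except `hMR`): `p ≥ 5`; `e` prime with `e + 1 < p`; `ord_p j ≥ 0` on both sides;
`ord_p Δ = n` and `12 t = e n` on both sides (the models `W`, `Y` need not be minimal). Conclusion: for
every `Γ_ℚ`-isomorphism `θ : W[p] ⥲ Y[p]` and every place `v ∋ p`, the local Selmer condition of `W` at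
`ℚ_v` implies that of `Y` for `θ_* c` — the `(d3)` disjunct of the GEN 27 consumers at the place over
`p` (`(u3)`: swap `W`, `Y`). Proof: part (e5) `localLe_of_goodReduction_above_tower_rat` over
`K' = ℚ(p^{1/e})` (`[K' : ℚ] = e < p − 1`, §2) with the good-reduction certificates of §1 for both base
changes. Conditional on the named fact A308 (`hMR`) only.
[cite: MazurRubin2015SelmerCompanions, Thm. 3.1 (iv)(b) and §6 proof Case 5]
[cite: SilvermanAEC2009, VII.5 Prop. 5.1(a)] -/
theorem localLe_of_potGood_root
    (hMR : MazurRubin2015.selmerLocalKer_iff_of_goodReduction_above)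
    (W Y : WeierstrassCurve ℚ) [W.IsElliptic] [Y.IsElliptic] (p e : ℕ) [hp : Fact p.Prime]
    (hp5 : 5 ≤ p) (he : e.Prime) (hep : e + 1 < p)
    (hjW : 0 ≤ padicValRat p W.j) (hjY : 0 ≤ padicValRat p Y.j)
    (nW tW : ℕ) (hnW : padicValRat p W.Δ = nW) (htW : 12 * tW = e * nW)
    (nY tY : ℕ) (hnY : padicValRat p Y.Δ = nY) (htY : 12 * tY = e * nY)
    (θ : geomTorsion W (p : ℤ) ≃+ geomTorsion Y (p : ℤ))
    (hθ : ∀ (σ : Field.absoluteGaloisGroup ℚ) (P : geomTorsion W (p : ℤ)), θ (σ • P) = σ • θ P)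
    (v : HeightOneSpectrum (𝓞 ℚ)) (hv : ((p : ℕ) : 𝓞 ℚ) ∈ v.asIdeal)
    (c : galH1Torsion W (p : ℤ)) (hc : c ∈ selmerLocalKer W (v.adicCompletion ℚ) (p : ℤ)) :
    h1Equiv θ hθ c ∈ selmerLocalKer Y (v.adicCompletion ℚ) (p : ℤ) := by
  haveI : Fact e.Prime := ⟨he⟩
  have hp2 : p ≠ 2 := by omega
  exact localLe_of_goodReduction_above_tower_rat hMR hp2 W Y (RootField e p)
    (by rw [finrank_rootField e p]; omega)
    (fun w hw => hasGoodReductionAt_baseChange_of_pow_eq_natCast W p hp5 hjW (RootField e p)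
      (rootFieldGen e p) (rootFieldGen_pow e p) hnW htW w hw)
    (fun w hw => hasGoodReductionAt_baseChange_of_pow_eq_natCast Y p hp5 hjY (RootField e p)
      (rootFieldGen e p) (rootFieldGen_pow e p) hnY htY w hw)
    θ hθ v hv c hc

/-- **Record-facing form of `localLe_of_potGood_root`**: the numeric hypotheses are read off the two
MINIMAL integer models `E_W = integralModelInt W`, `E_Y = integralModelInt Y` as kernel-decidable
integer divisibilities — `p^a ∣ c₄`, `p^n ∣ Δ`, `p^{n+1} ∤ Δ`, `n ≤ 3a` (so `ord_p j = 3 ord_p c₄ − n ≥ 0`,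
tree `padicValRat_j_nonneg_of_intModel`; `ord_p Δ(W) = n`, tree `IntModel.Δ_eq_cast`,
`IntModel.padicValInt_eq_of_dvd_of_not_dvd`) and `12 t = e n`. Conditional on A308 (`hMR`) only.
[cite: MazurRubin2015SelmerCompanions, Thm. 3.1 (iv)(b) and §6 proof Case 5]
[cite: SilvermanAEC2009, VII.5 Prop. 5.1(a) and VII.1] -/
theorem localLe_of_potGood_root_of_intModel
    (hMR : MazurRubin2015.selmerLocalKer_iff_of_goodReduction_above)
    (W Y : WeierstrassCurve ℚ) [W.IsElliptic] [Y.IsElliptic] [W.IsGloballyMinimal]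
    [Y.IsGloballyMinimal] {EW EY : WeierstrassCurve ℤ} (hIW : integralModelInt W = EW)
    (hIY : integralModelInt Y = EY) (p e : ℕ) [hp : Fact p.Prime]
    (hp5 : 5 ≤ p) (he : e.Prime) (hep : e + 1 < p)
    (aW nW tW : ℕ) (hcW : (p : ℤ) ^ aW ∣ EW.c₄) (hΔW : (p : ℤ) ^ nW ∣ EW.Δ)
    (hΔW' : ¬ (p : ℤ) ^ (nW + 1) ∣ EW.Δ) (haW : nW ≤ 3 * aW) (htW : 12 * tW = e * nW)
    (aY nY tY : ℕ) (hcY : (p : ℤ) ^ aY ∣ EY.c₄) (hΔY : (p : ℤ) ^ nY ∣ EY.Δ)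
    (hΔY' : ¬ (p : ℤ) ^ (nY + 1) ∣ EY.Δ) (haY : nY ≤ 3 * aY) (htY : 12 * tY = e * nY)
    (θ : geomTorsion W (p : ℤ) ≃+ geomTorsion Y (p : ℤ))
    (hθ : ∀ (σ : Field.absoluteGaloisGroup ℚ) (P : geomTorsion W (p : ℤ)), θ (σ • P) = σ • θ P)
    (v : HeightOneSpectrum (𝓞 ℚ)) (hv : ((p : ℕ) : 𝓞 ℚ) ∈ v.asIdeal)
    (c : galH1Torsion W (p : ℤ)) (hc : c ∈ selmerLocalKer W (v.adicCompletion ℚ) (p : ℤ)) :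
    h1Equiv θ hθ c ∈ selmerLocalKer Y (v.adicCompletion ℚ) (p : ℤ) := by
  have hjW : 0 ≤ padicValRat p W.j :=
    padicValRat_j_nonneg_of_intModel hIW p aW hcW
      fun h => hΔW' (dvd_trans (pow_dvd_pow _ (by omega)) h)
  have hjY : 0 ≤ padicValRat p Y.j :=
    padicValRat_j_nonneg_of_intModel hIY p aY hcY
      fun h => hΔY' (dvd_trans (pow_dvd_pow _ (by omega)) h)
  have hnW : padicValRat p W.Δ = nW := by
    rw [IntModel.Δ_eq_cast hIW, padicValRat.of_int, IntModel.padicValInt_eq_of_dvd_of_not_dvd p hΔW hΔW']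
  have hnY : padicValRat p Y.Δ = nY := by
    rw [IntModel.Δ_eq_cast hIY, padicValRat.of_int, IntModel.padicValInt_eq_of_dvd_of_not_dvd p hΔY hΔY']
  exact localLe_of_potGood_root hMR W Y p e hp5 he hep hjW hjY nW tW hnW htW nY tY hnY htY θ hθ v hv
    c hc

end Summit.BirchSwinnertonDyer.Rank1Residual.X11b.CongruentTransfer

end
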